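import Summits.CriticalPhenomena.Ising3DConformalLimit.Theses.HyperoctahedralRP
import Summits.CriticalPhenomena.Ising3DConformalLimit.Theorems.MoebiusLimitExists.Negative.FreeTranslations
import Summits.CriticalPhenomena.Ising3DConformalLimit.Theorems.MoebiusLimitExists.Negative.ScaleRedundant
import Summits.CriticalPhenomena.Ising3DConformalLimit.Theorems.MoebiusLimitExists.Negative.TwoPointPositivity
import Summits.CriticalPhenomena.Ising3DConformalLimit.Theorems.MoebiusLimitExists.Negative.OnlyInteractionTightness
import Summits.CriticalPhenomena.Ising3DConformalLimit.Theorems.MoebiusLimitExists.Negative.LocalBoundsDoubling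
import Literature.Probability.LatticeModels.PointwiseScalingLimitScale
import Literature.Probability.LatticeModels.PointwiseScalingLimitEtaExists
import Literature.Probability.LatticeModels.CriticalUrsellFourSign
import HarnessLib

/-!
# `ExistsScaleCovariantLimit` (item stmt-CriticalPhenomena-1981): the PINNED form and two
renormalisation-free lattice refutation criteria

Negative / structural knowledge about the crux
`Summit.CriticalPhenomena.Ising3DConformalLimit.Theses.HyperoctahedralRP.ExistsScaleCovariantLimit`,
standing crux disprover, cycle 2 (D-0016); THEOREM-ONLY.

* `hasPointwiseScalingLimit_rhoPin`: under any non-degenerate limit witness `(ρ, S')`, the PINNED zoom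
  (`ρ_pin(δ) = ⟨σ₀σ_{⌊1/δ⌋e₀}⟩_{β_c}^{-1/2}`, `rhoPin`) converges along the FULL filter to `aⁿ S'ₙ`
  (the sibling `OnlyInteractionTightness` has this along mesh sequences).
* `iff_pinned`: **crux ⟺ `∃ S, HasPointwiseScalingLimit (criticalCorr 3) rhoPin S`** — no unknown
  renormalisation, no `Δ`, no symmetry clause; non-degeneracy is automatic (`S₂(0,e₀) = 1`).
* `axis_ratio_tendsto`: crux ⟹ `⟨σ₀σ_{⌊s m⌋e₀}⟩/⟨σ₀σ_{m e₀}⟩ → s^{-2Δ}` for all real `s > 0` (axis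
  regular variation; a log-periodic modulation of the axis two-point sequence refutes the crux).
* `fourPoint_ratio_tendsto`, `fourRatio_smul`, `fourRatio_translate`: crux ⟹ the RAW lattice ratio
  `G₄/(G₂G₂)` at `[x/δ]` converges, for every non-coincident quadruple, to a dilation-INVARIANT,
  translation-invariant `Q(x)` — a constant-free, Monte-Carlo-accessible observable whose `δ`-drift at
  one `x` would refute the crux.

Reference: H. Duminil-Copin, Proc. ICM 2022, §8.1 eq. (8.1) and §8.4 p. 29 [DuminilCopinICM2022].
-/

noncomputable section

namespace Summit.CriticalPhenomena.Ising3DConformalLimit.ExistsScaleCovariantLimitNegative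

open Literature.Probability.LatticeModels Filter Set
open scoped Topology
open Summit.CriticalPhenomena.Ising3DConformalLimit.Theses
open Summit.CriticalPhenomena.Ising3DConformalLimit.MoebiusLimitExistsNegative
open Summit.CriticalPhenomena.Ising3DConformalLimit.MoebiusLimitExistsOnlyInteraction (rhoPin)
open Summit.CriticalPhenomena.Ising3DConformalLimit.PinnedClusterPoints
open Summit.CriticalPhenomena.Ising3DConformalLimit.OnlyInteractionTightness (limit_isBoundedUnder)
open Classical

/-- **The pinned zoom converges along the FULL filter under any non-degenerate witness.** [folklore] -/
theorem hasPointwiseScalingLimit_rhoPin {ρ : ℝ → ℝ} {S' : CorrFamily 3}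
    (hρ : ∀ δ ∈ Set.Ioc (0:ℝ) 1, 0 < ρ δ)
    (hlim : HasPointwiseScalingLimit (criticalCorr 3) ρ S') (hnd : IsNondegenerateTwoPoint S') :
    HasPointwiseScalingLimit (criticalCorr 3) rhoPin
      (fun n x => ((S' 2 (![0, EuclideanSpace.single 0 1] : Fin 2 → EuclideanSpace ℝ (Fin 3))) ^
        (-(1 / 2 : ℝ))) ^ n * S' n x) := by
  intro n
  have hA : 0 < S' 2 (![0, EuclideanSpace.single 0 1] : Fin 2 → EuclideanSpace ℝ (Fin 3)) :=
    hnd _ cfg01_mem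
  set r : ℝ → ℝ := fun δ => (rescaledCorrelator (criticalCorr 3) ρ 2 δ
    (![0, EuclideanSpace.single 0 1] : Fin 2 → EuclideanSpace ℝ (Fin 3))) ^ (-(1 / 2 : ℝ)) with hr
  have hr_t : Tendsto (fun δ => r δ ^ n) (𝓝[>] (0:ℝ))
      (𝓝 (((S' 2 (![0, EuclideanSpace.single 0 1] : Fin 2 → EuclideanSpace ℝ (Fin 3))) ^
        (-(1 / 2 : ℝ))) ^ n)) := by
    have h2 : Tendsto (fun δ => rescaledCorrelator (criticalCorr 3) ρ 2 δ
        (![0, EuclideanSpace.single 0 1] : Fin 2 → EuclideanSpace ℝ (Fin 3))) (𝓝[>] (0:ℝ))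
        (𝓝 (S' 2 (![0, EuclideanSpace.single 0 1] : Fin 2 → EuclideanSpace ℝ (Fin 3)))) :=
      (hlim 2).tendsto_at cfg01_mem
    exact (h2.rpow_const (p := -(1 / 2 : ℝ)) (Or.inl hA.ne')).pow n
  have hF1 : TendstoLocallyUniformlyOn (fun δ (_ : Fin n → EuclideanSpace ℝ (Fin 3)) => r δ ^ n)
      (fun _ => ((S' 2 (![0, EuclideanSpace.single 0 1] : Fin 2 → EuclideanSpace ℝ (Fin 3))) ^
        (-(1 / 2 : ℝ))) ^ n) (𝓝[>] (0:ℝ)) (NonCoincident 3 n) :=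
    (hr_t.tendstoUniformlyOn_const (NonCoincident 3 n)).tendstoLocallyUniformlyOn
  have hprod := hF1.mul₀_of_isBoundedUnder (hlim n)
    (fun x _ => isBoundedUnder_of ⟨dist (((S' 2 (![0, EuclideanSpace.single 0 1] : Fin 2 →
      EuclideanSpace ℝ (Fin 3))) ^ (-(1 / 2 : ℝ))) ^ n) 0, fun _ => le_rfl⟩)
    (fun x hx => limit_isBoundedUnder hlim n hx)
  refine hprod.congr_inseparable ?_
  filter_upwards [Ioc_mem_nhdsGT one_pos] with δ hδ x _
  exact Inseparable.of_eq (rescaled_pin_eq (hρ δ hδ) n x).symm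

/-- `ρ_pin > 0` everywhere. [folklore] -/
theorem rhoPin_pos (δ : ℝ) : 0 < rhoPin δ :=
  Real.rpow_pos_of_pos (criticalTwoPoint_pos3 _) _

/-- A pinned limit has `S₂(0,e₀) = 1`. [folklore] -/
theorem pinned_cfg01 {S : CorrFamily 3} (hlim : HasPointwiseScalingLimit (criticalCorr 3) rhoPin S) :
    S 2 (![0, EuclideanSpace.single 0 1] : Fin 2 → EuclideanSpace ℝ (Fin 3)) = 1 := by
  have h := (hlim 2).tendsto_at cfg01_mem
  simp_rw [rescaled_pin_cfg01] at h
  exact (tendsto_nhds_unique tendsto_const_nhds h).symm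

/-- **crux ⟺ THE PINNED ZOOM CONVERGES** (full filter, every `n`, locally uniformly off the
diagonals): the `ρ`-free, `Δ`-free, symmetry-free form of the crux. [cite: DuminilCopinICM2022, §8.4 p. 29] -/
theorem iff_pinned :
    HyperoctahedralRP.ExistsScaleCovariantLimit ↔
      ∃ S : CorrFamily 3, HasPointwiseScalingLimit (criticalCorr 3) rhoPin S := by
  constructor
  · rintro ⟨ρ, Δ, S', hρ, -, hlim, -, hnd, -, -⟩
    exact ⟨_, hasPointwiseScalingLimit_rhoPin hρ hlim hnd⟩
  · rintro ⟨S, hlim⟩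
    have h1 := pinned_cfg01 hlim
    have hnd : IsNondegenerateTwoPoint S :=
      (isNondegenerateTwoPoint_iff_exists_pos hlim).2 ⟨_, cfg01_mem, by rw [h1]; exact one_pos⟩
    have hρ : ∀ δ ∈ Set.Ioc (0:ℝ) 1, 0 < rhoPin δ := fun δ _ => rhoPin_pos δ
    obtain ⟨Δ, hwin, hsc⟩ := exists_scaleCovariant_normalised hρ hlim hnd
    exact ⟨rhoPin, Δ, fun n x => if x ∈ NonCoincident 3 n then S n x else 0, hρ, by linarith [hwin.1],
      normalised_hasLimit hlim, fun n z hz => if_neg hz, normalised_nondeg hnd,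
      isTranslationInvariant_normalised_of_limit hlim, hsc⟩

/-- **Refutation criterion 1 (axis regular variation)**, `ρ`-free and `S`-free: under the crux there
is `Δ ∈ [1/2, 3/4]` with `⟨σ₀σ_{⌊s(k+1)⌋e₀}⟩_{β_c} / ⟨σ₀σ_{(k+1)e₀}⟩_{β_c} → s^{-2Δ}` for every real
`s > 0`. [cite: DuminilCopinICM2022, §8.4 p. 29] -/
theorem axis_ratio_tendsto (h : HyperoctahedralRP.ExistsScaleCovariantLimit) :
    ∃ Δ ∈ Set.Icc (1/2:ℝ) (3/4), ∀ s : ℝ, 0 < s →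
      Tendsto (fun k : ℕ => criticalTwoPoint 3 (Pi.single 0 ⌊s * ((k:ℝ) + 1)⌋) /
        criticalTwoPoint 3 (Pi.single 0 (((k + 1 : ℕ) : ℤ)))) atTop (𝓝 (s ^ (-(2:ℝ) * Δ))) := by
  obtain ⟨S, hlim⟩ := iff_pinned.1 h
  have hρ : ∀ δ ∈ Set.Ioc (0:ℝ) 1, 0 < rhoPin δ := fun δ _ => rhoPin_pos δ
  have h1 := pinned_cfg01 hlim
  have hnd : IsNondegenerateTwoPoint S :=
    (isNondegenerateTwoPoint_iff_exists_pos hlim).2 ⟨_, cfg01_mem, by rw [h1]; exact one_pos⟩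
  obtain ⟨Δ, hΔ, hcov, -, -⟩ := hlim.exists_rpow_scale_mem_Icc_threeQuarters hρ hnd
  refine ⟨Δ, hΔ, fun s hs => ?_⟩
  have hval : S 2 (![0, EuclideanSpace.single 0 s] : Fin 2 → EuclideanSpace ℝ (Fin 3)) =
      s ^ (-(2:ℝ) * Δ) := by
    have hc := hcov 2 s hs _ cfg01_mem
    rw [h1, mul_one] at hc
    have hcfg : (fun i => s • ((![0, EuclideanSpace.single 0 1] : Fin 2 → EuclideanSpace ℝ (Fin 3)) i)) =
        (![0, EuclideanSpace.single 0 s] : Fin 2 → EuclideanSpace ℝ (Fin 3)) := by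
      funext i
      fin_cases i
      · simp
      · simp only [Matrix.cons_val_one, Matrix.cons_val_fin_one, Fin.mk_one]
        ext j
        by_cases hj : j = 0
        · subst hj; simp
        · simp [hj]
    rw [hcfg] at hc
    exact_mod_cast hc
  have ht := ((hlim 2).tendsto_at (zero_unitVec_mem_nonCoincident hs.ne')).comp
    (tendsto_div_succ_nhdsGT one_pos)
  rw [hval] at ht
  refine ht.congr fun k => ?_
  simp only [Function.comp_apply, rescaled_pin_cfg0s]
  have e1 : s / (1 / ((k:ℝ) + 1)) = s * ((k:ℝ) + 1) := by field_simp
  have e2 : (1:ℝ) / (1 / ((k:ℝ) + 1)) = ((k + 1 : ℕ) : ℝ) := by push_cast; field_simp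
  rw [e1, e2, Int.floor_natCast]

/-- **Refutation criterion 2 (a renormalisation-free four-point observable converges)**: under a
witness, the RAW lattice ratio `G₄([x/δ]) / (G₂([x₀/δ],[x₁/δ]) G₂([x₂/δ],[x₃/δ]))` — no `ρ`, no `Δ` —
converges as `δ → 0⁺` for every non-coincident quadruple `x`. [folklore] -/
theorem fourPoint_ratio_tendsto {ρ : ℝ → ℝ} {S : CorrFamily 3}
    (hρ : ∀ δ ∈ Set.Ioc (0:ℝ) 1, 0 < ρ δ) (hlim : HasPointwiseScalingLimit (criticalCorr 3) ρ S)
    (hnd : IsNondegenerateTwoPoint S)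
    {x : Fin 4 → EuclideanSpace ℝ (Fin 3)} (hx : x ∈ NonCoincident 3 4) :
    Tendsto (fun δ => criticalCorr 3 4 (fun i => latticeApprox δ (x i)) /
      (criticalCorr 3 2 (fun i => latticeApprox δ ((![x 0, x 1] : Fin 2 → _) i)) *
        criticalCorr 3 2 (fun i => latticeApprox δ ((![x 2, x 3] : Fin 2 → _) i))))
      (𝓝[>] (0:ℝ)) (𝓝 (S 4 x / (S 2 ![x 0, x 1] * S 2 ![x 2, x 3]))) := by
  have hinj : Function.Injective x := hx
  have h01 : (![x 0, x 1] : Fin 2 → EuclideanSpace ℝ (Fin 3)) ∈ NonCoincident 3 2 :=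
    pair_mem_nonCoincident (hinj.ne (by decide))
  have h23 : (![x 2, x 3] : Fin 2 → EuclideanSpace ℝ (Fin 3)) ∈ NonCoincident 3 2 :=
    pair_mem_nonCoincident (hinj.ne (by decide))
  have t4 := (hlim 4).tendsto_at hx
  have t01 := (hlim 2).tendsto_at h01
  have t23 := (hlim 2).tendsto_at h23
  have hpos : 0 < S 2 ![x 0, x 1] * S 2 ![x 2, x 3] := mul_pos (hnd _ h01) (hnd _ h23)
  have hq := t4.div (t01.mul t23) hpos.ne'
  refine hq.congr' ?_
  filter_upwards [Ioc_mem_nhdsGT one_pos] with δ hδ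
  have hρ0 : ρ δ ≠ 0 := (hρ δ hδ).ne'
  simp only [rescaledCorrelator_apply, Pi.div_apply]
  have e : ρ δ ^ 2 * criticalCorr 3 2 (fun i => latticeApprox δ ((![x 0, x 1] : Fin 2 → _) i)) *
      (ρ δ ^ 2 * criticalCorr 3 2 (fun i => latticeApprox δ ((![x 2, x 3] : Fin 2 → _) i))) =
      ρ δ ^ 4 * (criticalCorr 3 2 (fun i => latticeApprox δ ((![x 0, x 1] : Fin 2 → _) i)) *
        criticalCorr 3 2 (fun i => latticeApprox δ ((![x 2, x 3] : Fin 2 → _) i))) := by ring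
  rw [e, mul_div_mul_left _ _ (pow_ne_zero 4 hρ0)]

/-- Its limit `Q = S₄/(S₂S₂)` is dilation INVARIANT for a scale-covariant family. [folklore] -/
theorem fourRatio_smul {Δ : ℝ} {S : CorrFamily 3} (hsc : IsScaleCovariant Δ S)
    {c : ℝ} (hc : 0 < c) (x : Fin 4 → EuclideanSpace ℝ (Fin 3)) :
    S 4 (fun i => c • x i) / (S 2 ![c • x 0, c • x 1] * S 2 ![c • x 2, c • x 3]) =
      S 4 x / (S 2 ![x 0, x 1] * S 2 ![x 2, x 3]) := by
  have e4 := hsc 4 c hc x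
  have e01 := hsc 2 c hc ![x 0, x 1]
  have e23 := hsc 2 c hc ![x 2, x 3]
  have c01 : (fun i => c • (![x 0, x 1] : Fin 2 → EuclideanSpace ℝ (Fin 3)) i) = ![c • x 0, c • x 1] := by
    funext i; fin_cases i <;> rfl
  have c23 : (fun i => c • (![x 2, x 3] : Fin 2 → EuclideanSpace ℝ (Fin 3)) i) = ![c • x 2, c • x 3] := by
    funext i; fin_cases i <;> rfl
  rw [c01] at e01
  rw [c23] at e23
  rw [e4, e01, e23]
  have hpow : c ^ (-((4:ℕ):ℝ) * Δ) = c ^ (-((2:ℕ):ℝ) * Δ) * c ^ (-((2:ℕ):ℝ) * Δ) := by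
    rw [← Real.rpow_add hc]; congr 1; push_cast; ring
  rw [hpow]
  have hne : c ^ (-((2:ℕ):ℝ) * Δ) ≠ 0 := (Real.rpow_pos_of_pos hc _).ne'
  rw [show c ^ (-((2:ℕ):ℝ) * Δ) * S 2 ![x 0, x 1] * (c ^ (-((2:ℕ):ℝ) * Δ) * S 2 ![x 2, x 3]) =
      (c ^ (-((2:ℕ):ℝ) * Δ) * c ^ (-((2:ℕ):ℝ) * Δ)) * (S 2 ![x 0, x 1] * S 2 ![x 2, x 3]) by ring,
    mul_div_mul_left _ _ (mul_ne_zero hne hne)]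

/-- … and translation invariant for a translation-invariant family. [folklore] -/
theorem fourRatio_translate {S : CorrFamily 3} (htr : IsTranslationInvariant S)
    (v : EuclideanSpace ℝ (Fin 3)) (x : Fin 4 → EuclideanSpace ℝ (Fin 3)) :
    S 4 (fun i => x i + v) / (S 2 ![x 0 + v, x 1 + v] * S 2 ![x 2 + v, x 3 + v]) =
      S 4 x / (S 2 ![x 0, x 1] * S 2 ![x 2, x 3]) := by
  have c01 : (fun i => (![x 0, x 1] : Fin 2 → EuclideanSpace ℝ (Fin 3)) i + v) = ![x 0 + v, x 1 + v] := by
    funext i; fin_cases i <;> rfl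
  have c23 : (fun i => (![x 2, x 3] : Fin 2 → EuclideanSpace ℝ (Fin 3)) i + v) = ![x 2 + v, x 3 + v] := by
    funext i; fin_cases i <;> rfl
  have e01 := htr 2 v ![x 0, x 1]
  have e23 := htr 2 v ![x 2, x 3]
  rw [c01] at e01
  rw [c23] at e23
  rw [htr 4 v x, e01, e23]

end Summit.CriticalPhenomena.Ising3DConformalLimit.ExistsScaleCovariantLimitNegative

end
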